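import Mathlib
import HarnessLib
import Summits.Ventures.LatticeQCDFlow.Scoring.DoeblinSkeleton

/-!
# Evolutions restarted from a correlated prior chain: the record autocovariances at lag `t ≥ 1` ARE
# the prior chain's autocovariances of the conditional mean `h(x) = E[G | start x]`

HONEST FRAMING: exact (Metropolis-corrected) sampling algorithms for lattice gauge theory;
figures of merit are autocorrelation/cost numbers at stated couplings and volumes; no
continuum-physics claim.

Venture `LatticeQCDFlow` (cell pub-lqcd), topic `Scoring`; FANOUT row 8 (`s0-cpn-nemc`, GEN-12 — the
row's own protocol: Bonanno–Nada–Vadacchino's non-equilibrium evolutions are started every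
`n_between` sweeps of an EQUILIBRIUM PRIOR CHAIN, so successive Jarzynski weights `e^{−W_i}` are
correlated through their starting configurations; BNV 2024 / Bonanno et al. 2025 NAMED ONLY).  NEW
WORK of the cell, not a published result; no definition is introduced.  Kernel-level bookkeeping over
Mathlib's `Kernel.compProd` / `Kernel.prodMkRight` / `Kernel.prodMkLeft` / `Measure.compProd` and this row's `kop` / `autocov`
(`Scoring/KernelTransitionOperator.lean`), the envelope of `Scoring/DoeblinAutocorrelation.lean` and
`kop_nHit` of `Scoring/DoeblinSkeleton.lean`.

## The restart chain (no new definition; written out in every statement)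

Prior kernel `κ₀` on configurations `Ω` (Markov, invariant probability law `π₀`), record kernel
`κF : Kernel Ω E` (Markov: from a start `x`, draw a whole forward evolution / record `ω ∼ κF x`).
The RESTART CHAIN on `Ω × E` moves `(x, ω) ↦ (x', ω')` with `x' ∼ κ₀(x, ·)`, `ω' ∼ κF(x', ·)`:
`K = prodMkRight E κ₀ ⊗ₖ prodMkLeft (Ω × E) κF` (Mathlib's `Kernel.compProd`), `K(x, ω) = κ₀ x ⊗ₘ κF` (`restart_apply`); its invariant law is
`Π = π₀ ⊗ₘ κF` (`invariant_restart`).  An observable of the record is a bounded measurable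
`G : Ω × E → ℝ` (a Jarzynski weight `e^{−W(ω)}` truncated, an end-point observable, an indicator);
its CONDITIONAL MEAN given the start is `h(x) = ∫ G(x, ω) κF(x, dω)`.

## Content

* `restart_apply`, `restart_apply_comp`, `invariant_restart` (exactness of the restart chain for
  `Π`), `measurable_condMean` / `abs_condMean_le` / `integral_condMean` (`∫ h dπ₀ = ∫ G dΠ`);
* **`kop_restart`**, **`iterate_kop_restart`** — `(kop K)^[t+1] G (x, ω) = ((kop κ₀)^[t+1] h)(x)`:
  after one step the record is forgotten, only the start chain propagates;
* **`autocov_restart_succ`** — THE LAW: `C^K_G(t + 1) = C^{κ₀}_h(t + 1)` for every `t`;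
  `autocov_restart_zero_ge` — `C^{κ₀}_h(0) ≤ C^K_G(0)` (Jensen: the lag-0 term carries the extra
  WITHIN-EVOLUTION variance `E Var(G | start)`);
* **`tauInt_restart_eq`** — for `G` with `Var_{π₀} h ≠ 0` (Lean's `∑'` convention makes the
  identity unconditional; it is the intended law when `ρ_h` is summable):
  `τ_int^K(G) = 1/2 + (Var_{π₀} h / Var_Π G) · (τ_int^{κ₀}(h) − 1/2)` — the dilution law: correlated
  restarts cost the prior chain's autocorrelation time of the conditional mean, diluted by the
  variance fraction `Var h / Var G ≤ 1`; `tauInt_restart_le` (`τ_int^K(G) ≤ τ_int^{κ₀}(h)` whenever the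
  latter is `≥ 1/2`);
* **`abs_autocov_restart_le_of_doeblin`**, **`tauInt_restart_le_of_doeblin`** — a Doeblin constant
  `ε₀` of the PRIOR chain by `π₀` gives `|C^K_G(t+1)| ≤ (1 − ε₀)^{t+1} Var_{π₀} h` and
  `τ_int^K(G) ≤ 1/2 + (Var h/Var G)(1/ε₀ − 1) ≤ 1/ε₀ − 1/2` for every bounded record observable;
* `autocov_restart_succ_nHit` — with `κ₀ = nHit κ m` (restart every `m` sweeps of `κ`):
  `C^K_G(t + 1) = C^{κ}_h(m (t + 1))`, the stride dictionary.

Reading (value-free, for row 8's S0-D2 protocol and rows 13 / 19 / 23 / 24): the autocorrelation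
of successive non-equilibrium weights is NOT a property of the evolutions but of the prior chain seen
through `h(x) = E[e^{−W} | start x]`; `n_between` enters only as the stride `m`; when the evolution
noise dominates (`Var h ≪ Var e^{−W}`) the weights are nearly uncorrelated at ANY stride, and when
the start determines the work the weights inherit the prior sweep's `τ_int(h)` at stride `m`.
NOT CLAIMED: any number of ours; unbounded weights (`e^{−W}` is bounded only under a work floor);
the Kish/ESS combination of weight variance and weight autocorrelation (markdown, RESULTS §7–§11).
-/

noncomputable section

namespace Summit.Ventures.LatticeQCDFlow.Scoring

open MeasureTheory ProbabilityTheory Filter Set Summit.Ventures.LatticeQCDFlow.Exactness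
open scoped ENNReal

variable {Ω E : Type*} [MeasurableSpace Ω] [MeasurableSpace E]

section Restart

variable {κ₀ : Kernel Ω Ω} [IsMarkovKernel κ₀] {κF : Kernel Ω E} [IsMarkovKernel κF]
  {π₀ : Measure Ω} [IsProbabilityMeasure π₀]

/-! ### The kernel and its invariant law -/

omit [IsMarkovKernel κ₀] in
/-- From `(x, ω)` the restart chain draws `x' ∼ κ₀ x` and then a fresh record `ω' ∼ κF x'`:
`K(x, ω) = κ₀ x ⊗ₘ κF` (the old record is forgotten). -/
theorem restart_apply [IsSFiniteKernel κ₀] (p : Ω × E) :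
    ((Kernel.prodMkRight E κ₀) ⊗ₖ (Kernel.prodMkLeft (Ω × E) κF)) p
      = κ₀ p.1 ⊗ₘ κF := by
  rw [Kernel.compProd_apply_eq_compProd_sectR, Kernel.prodMkRight_apply, Kernel.sectR_prodMkLeft]

omit [IsMarkovKernel κ₀] in
/-- … equivalently `K(x, ω) = ((id ×ₖ κF) ∘ₖ κ₀)(x)`. -/
theorem restart_apply_comp [IsSFiniteKernel κ₀] (p : Ω × E) :
    ((Kernel.prodMkRight E κ₀) ⊗ₖ (Kernel.prodMkLeft (Ω × E) κF)) p
      = ((Kernel.id ×ₖ κF) ∘ₖ κ₀) p.1 := by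
  rw [restart_apply, Measure.compProd_eq_comp_prod, Kernel.comp_apply]

/-- **The restart chain is exact for `Π = π₀ ⊗ₘ κF`** whenever the prior chain is exact for `π₀`. -/
theorem invariant_restart (hπ₀ : Kernel.Invariant κ₀ π₀) :
    Kernel.Invariant ((Kernel.prodMkRight E κ₀) ⊗ₖ (Kernel.prodMkLeft (Ω × E) κF))
      (π₀ ⊗ₘ κF) := by
  change (π₀ ⊗ₘ κF).bind _ = π₀ ⊗ₘ κF
  ext S hS
  rw [Measure.bind_apply hS (Kernel.aemeasurable _)]
  simp_rw [restart_apply_comp]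
  have hmeas : Measurable fun x : Ω => ((Kernel.id ×ₖ κF) ∘ₖ κ₀) x S := Kernel.measurable_coe _ hS
  rw [← lintegral_map hmeas measurable_fst]
  have hfst : (π₀ ⊗ₘ κF).map Prod.fst = π₀ := Measure.fst_compProd π₀ κF
  rw [hfst, ← Measure.bind_apply hS (Kernel.aemeasurable _)]
  change (((Kernel.id ×ₖ κF) ∘ₖ κ₀) ∘ₘ π₀) S = _
  rw [← Measure.comp_assoc, hπ₀.def, ← Measure.compProd_eq_comp_prod]

/-! ### The conditional mean `h(x) = ∫ G(x, ω) κF(x, dω)` -/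

omit [IsMarkovKernel κ₀] [IsProbabilityMeasure π₀] in
/-- `h` is measurable … -/
theorem measurable_condMean {G : Ω × E → ℝ} (hG : Measurable G) :
    Measurable fun x => ∫ ω, G (x, ω) ∂(κF x) :=
  (hG.stronglyMeasurable.integral_kernel_prod_right' (κ := κF)).measurable

omit [IsMarkovKernel κ₀] [IsProbabilityMeasure π₀] in
/-- … bounded by the bound of `G` … -/
theorem abs_condMean_le {G : Ω × E → ℝ} {C : ℝ} (hC : ∀ p, |G p| ≤ C) (x : Ω) :
    |∫ ω, G (x, ω) ∂(κF x)| ≤ C := by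
  calc |∫ ω, G (x, ω) ∂(κF x)| = ‖∫ ω, G (x, ω) ∂(κF x)‖ := (Real.norm_eq_abs _).symm
    _ ≤ C * (κF x).real Set.univ := norm_integral_le_of_norm_le_const
        (Eventually.of_forall fun ω => by rw [Real.norm_eq_abs]; exact hC (x, ω))
    _ = C := by rw [probReal_univ, mul_one]

omit [IsMarkovKernel κ₀] in
/-- … and has the same mean: `∫ h dπ₀ = ∫ G dΠ`. -/
theorem integral_condMean {G : Ω × E → ℝ} (hG : Measurable G) {C : ℝ} (hC : ∀ p, |G p| ≤ C) :
    ∫ x, (∫ ω, G (x, ω) ∂(κF x)) ∂π₀ = ∫ p, G p ∂(π₀ ⊗ₘ κF) := by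
  rw [Measure.integral_compProd (integrable_of_bounded _ hG hC)]

/-! ### The transition operator forgets the record -/

/-- **`kop K G (x, ω) = (kop κ₀ h)(x)`** with `h(x') = ∫ G(x', ω') κF(x', dω')`. -/
theorem kop_restart {G : Ω × E → ℝ} (hG : Measurable G) {C : ℝ} (hC : ∀ p, |G p| ≤ C) :
    kop ((Kernel.prodMkRight E κ₀) ⊗ₖ (Kernel.prodMkLeft (Ω × E) κF)) G
      = fun p => kop κ₀ (fun x => ∫ ω, G (x, ω) ∂(κF x)) p.1 := by
  funext p
  unfold kop
  rw [restart_apply, Measure.integral_compProd (integrable_of_bounded _ hG hC)]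

/-- A function of the start alone is averaged by `κ₀` alone: `kop K (F ∘ fst) = (kop κ₀ F) ∘ fst`. -/
theorem kop_restart_comp_fst {F : Ω → ℝ} (hF : Measurable F) {C : ℝ} (hC : ∀ x, |F x| ≤ C) :
    kop ((Kernel.prodMkRight E κ₀) ⊗ₖ (Kernel.prodMkLeft (Ω × E) κF))
        (fun p => F p.1)
      = fun p => kop κ₀ F p.1 := by
  rw [kop_restart (G := fun p : Ω × E => F p.1) (hF.comp measurable_fst) (fun p => hC p.1)]
  funext p
  congr 1
  funext x
  show ∫ _ω, F x ∂(κF x) = F x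
  rw [integral_const, probReal_univ, one_smul]

/-- **`(kop K)^[t+1] G (x, ω) = ((kop κ₀)^[t+1] h)(x)`**: after the first step only the start chain
propagates. -/
theorem iterate_kop_restart {G : Ω × E → ℝ} (hG : Measurable G) {C : ℝ} (hC : ∀ p, |G p| ≤ C) :
    ∀ t : ℕ, (kop ((Kernel.prodMkRight E κ₀) ⊗ₖ (Kernel.prodMkLeft (Ω × E) κF)))^[t + 1] G
      = fun p => (kop κ₀)^[t + 1] (fun x => ∫ ω, G (x, ω) ∂(κF x)) p.1
  | 0 => by
    rw [Function.iterate_one, Function.iterate_one, kop_restart hG hC]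
  | t + 1 => by
    obtain ⟨hm, hb⟩ := iterate_kop_bounded_measurable κ₀ (measurable_condMean (κF := κF) hG)
      (fun x => abs_condMean_le (κF := κF) hC x) (t + 1)
    rw [Function.iterate_succ_apply'
        (kop ((Kernel.prodMkRight E κ₀) ⊗ₖ (Kernel.prodMkLeft (Ω × E) κF))) (t + 1) G,
      iterate_kop_restart hG hC t, kop_restart_comp_fst (κF := κF) hm hb]
    funext p
    simp only [Function.iterate_succ_apply']

/-! ### The law of the record autocovariances -/

/-- **THE RESTART LAW**: for every bounded measurable record observable `G` and every `t`,
`autocov K (π₀ ⊗ₘ κF) G (t + 1) = autocov κ₀ π₀ h (t + 1)` with `h` the conditional mean of `G` given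
the start — at every lag `≥ 1` the record chain's autocovariance IS the prior chain's
autocovariance of `h`. -/
theorem autocov_restart_succ {G : Ω × E → ℝ} (hG : Measurable G) {C : ℝ} (hC : ∀ p, |G p| ≤ C)
    (t : ℕ) :
    autocov ((Kernel.prodMkRight E κ₀) ⊗ₖ (Kernel.prodMkLeft (Ω × E) κF))
        (π₀ ⊗ₘ κF) G (t + 1)
      = autocov κ₀ π₀ (fun x => ∫ ω, G (x, ω) ∂(κF x)) (t + 1) := by
  obtain ⟨hm, hb⟩ := iterate_kop_bounded_measurable κ₀ (measurable_condMean (κF := κF) hG)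
    (fun x => abs_condMean_le (κF := κF) hC x) (t + 1)
  unfold autocov
  rw [iterate_kop_restart hG hC t]
  have hint : Integrable (fun p : Ω × E =>
      G p * (kop κ₀)^[t + 1] (fun x => ∫ ω, G (x, ω) ∂(κF x)) p.1) (π₀ ⊗ₘ κF) :=
    integrable_of_bounded _ (hG.mul (hm.comp measurable_fst)) (C := C * C) fun p => by
      rw [abs_mul]
      exact mul_le_mul (hC p) (hb p.1) (abs_nonneg _) ((abs_nonneg _).trans (hC p))
  rw [Measure.integral_compProd hint]
  refine integral_congr_ae (ae_of_all _ fun x => ?_)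
  show ∫ ω, G (x, ω) * (kop κ₀)^[t + 1] (fun x => ∫ ω, G (x, ω) ∂(κF x)) x ∂(κF x) = _
  rw [integral_mul_const]

omit [IsMarkovKernel κ₀] in
/-- **At lag `0` the record carries the extra within-evolution variance**:
`autocov κ₀ π₀ h 0 ≤ autocov K Π G 0`, i.e. `∫ h² dπ₀ ≤ ∫ G² dΠ` (Jensen per start). -/
theorem autocov_restart_zero_ge {G : Ω × E → ℝ} (hG : Measurable G) {C : ℝ} (hC : ∀ p, |G p| ≤ C) :
    autocov κ₀ π₀ (fun x => ∫ ω, G (x, ω) ∂(κF x)) 0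
      ≤ autocov ((Kernel.prodMkRight E κ₀) ⊗ₖ (Kernel.prodMkLeft (Ω × E) κF))
          (π₀ ⊗ₘ κF) G 0 := by
  rw [autocov_zero, autocov_zero]
  have hG2 : Integrable (fun p : Ω × E => G p ^ 2) (π₀ ⊗ₘ κF) :=
    integrable_of_bounded _ (hG.pow_const 2) (C := C ^ 2) fun p => by
      rw [abs_pow]; exact pow_le_pow_left₀ (abs_nonneg _) (hC p) 2
  rw [Measure.integral_compProd hG2]
  refine integral_mono_of_nonneg (ae_of_all _ fun x => sq_nonneg _) ?_
    (ae_of_all _ fun x => ?_)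
  · exact integrable_of_bounded _ (measurable_condMean (κF := κF) (hG.pow_const 2))
      (fun x => abs_condMean_le (κF := κF) (G := fun p => G p ^ 2) (C := C ^ 2) (fun p => by
        rw [abs_pow]; exact pow_le_pow_left₀ (abs_nonneg _) (hC p) 2) x)
  · exact sq_integral_le_integral_sq (κF x) (hG.comp measurable_prodMk_left) fun ω => hC (x, ω)

/-- In `ρ` form: `ρ^K_G(t+1) = C^{κ₀}_h(t+1) / C^K_G(0)`, and when `Var_{π₀} h ≠ 0`,
`ρ^K_G(t+1) = (C_h(0)/C_G(0)) · ρ^{κ₀}_h(t+1)`. -/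
theorem acf_restart_succ {G : Ω × E → ℝ} (hG : Measurable G) {C : ℝ} (hC : ∀ p, |G p| ≤ C)
    (h0 : autocov κ₀ π₀ (fun x => ∫ ω, G (x, ω) ∂(κF x)) 0 ≠ 0) (t : ℕ) :
    autocov ((Kernel.prodMkRight E κ₀) ⊗ₖ (Kernel.prodMkLeft (Ω × E) κF))
          (π₀ ⊗ₘ κF) G (t + 1)
        / autocov ((Kernel.prodMkRight E κ₀) ⊗ₖ (Kernel.prodMkLeft (Ω × E) κF))
          (π₀ ⊗ₘ κF) G 0
      = (autocov κ₀ π₀ (fun x => ∫ ω, G (x, ω) ∂(κF x)) 0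
          / autocov ((Kernel.prodMkRight E κ₀) ⊗ₖ (Kernel.prodMkLeft (Ω × E) κF))
              (π₀ ⊗ₘ κF) G 0)
        * (autocov κ₀ π₀ (fun x => ∫ ω, G (x, ω) ∂(κF x)) (t + 1)
            / autocov κ₀ π₀ (fun x => ∫ ω, G (x, ω) ∂(κF x)) 0) := by
  rw [autocov_restart_succ hG hC t, div_mul_div_comm, mul_comm, mul_div_mul_right _ _ h0]

/-- **THE DILUTION LAW**: for a bounded record observable `G` with `∫ h² dπ₀ ≠ 0` (`h` the
conditional mean): `τ_int^K(G) = 1/2 + (C_h(0)/C_G(0)) · (τ_int^{κ₀}(h) − 1/2)` — for `Π`-centred `G`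
the factor is `Var_{π₀} h / Var_Π G ≤ 1` (with Lean's `∑'` the identity needs no summability; it is
the intended law when `ρ_h` is summable). -/
theorem tauInt_restart_eq {G : Ω × E → ℝ} (hG : Measurable G) {C : ℝ} (hC : ∀ p, |G p| ≤ C)
    (h0 : autocov κ₀ π₀ (fun x => ∫ ω, G (x, ω) ∂(κF x)) 0 ≠ 0) :
    tauInt (fun t =>
        autocov ((Kernel.prodMkRight E κ₀) ⊗ₖ (Kernel.prodMkLeft (Ω × E) κF))
            (π₀ ⊗ₘ κF) G t
          / autocov ((Kernel.prodMkRight E κ₀) ⊗ₖ (Kernel.prodMkLeft (Ω × E) κF))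
            (π₀ ⊗ₘ κF) G 0)
      = 1 / 2 + (autocov κ₀ π₀ (fun x => ∫ ω, G (x, ω) ∂(κF x)) 0
          / autocov ((Kernel.prodMkRight E κ₀) ⊗ₖ (Kernel.prodMkLeft (Ω × E) κF))
              (π₀ ⊗ₘ κF) G 0)
        * (tauInt (fun t => autocov κ₀ π₀ (fun x => ∫ ω, G (x, ω) ∂(κF x)) t
            / autocov κ₀ π₀ (fun x => ∫ ω, G (x, ω) ∂(κF x)) 0) - 1 / 2) := by
  unfold tauInt
  simp_rw [acf_restart_succ hG hC h0]
  rw [tsum_mul_left]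
  ring

/-- Consequently `τ_int^K(G) ≤ τ_int^{κ₀}(h)` whenever the latter is at least `1/2` (and then
`τ_int^K(G) ≥ 1/2` too): correlated restarts never cost more than the prior chain's autocorrelation
time of the conditional mean. -/
theorem tauInt_restart_le {G : Ω × E → ℝ} (hG : Measurable G) {C : ℝ} (hC : ∀ p, |G p| ≤ C)
    (h0 : autocov κ₀ π₀ (fun x => ∫ ω, G (x, ω) ∂(κF x)) 0 ≠ 0)
    (hhalf : 1 / 2 ≤ tauInt (fun t => autocov κ₀ π₀ (fun x => ∫ ω, G (x, ω) ∂(κF x)) t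
      / autocov κ₀ π₀ (fun x => ∫ ω, G (x, ω) ∂(κF x)) 0)) :
    1 / 2 ≤ tauInt (fun t =>
        autocov ((Kernel.prodMkRight E κ₀) ⊗ₖ (Kernel.prodMkLeft (Ω × E) κF))
            (π₀ ⊗ₘ κF) G t
          / autocov ((Kernel.prodMkRight E κ₀) ⊗ₖ (Kernel.prodMkLeft (Ω × E) κF))
            (π₀ ⊗ₘ κF) G 0) ∧
      tauInt (fun t =>
        autocov ((Kernel.prodMkRight E κ₀) ⊗ₖ (Kernel.prodMkLeft (Ω × E) κF))
            (π₀ ⊗ₘ κF) G t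
          / autocov ((Kernel.prodMkRight E κ₀) ⊗ₖ (Kernel.prodMkLeft (Ω × E) κF))
            (π₀ ⊗ₘ κF) G 0)
        ≤ tauInt (fun t => autocov κ₀ π₀ (fun x => ∫ ω, G (x, ω) ∂(κF x)) t
            / autocov κ₀ π₀ (fun x => ∫ ω, G (x, ω) ∂(κF x)) 0) := by
  rw [tauInt_restart_eq hG hC h0]
  have hC0 : 0 ≤ autocov κ₀ π₀ (fun x => ∫ ω, G (x, ω) ∂(κF x)) 0 := by
    rw [autocov_zero]; exact integral_nonneg fun x => sq_nonneg _
  have hle := autocov_restart_zero_ge (κ₀ := κ₀) (κF := κF) (π₀ := π₀) hG hC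
  have hpos : 0 < autocov ((Kernel.prodMkRight E κ₀) ⊗ₖ (Kernel.prodMkLeft (Ω × E) κF))
      (π₀ ⊗ₘ κF) G 0 := (hC0.lt_of_ne (Ne.symm h0)).trans_le hle
  have hr0 : 0 ≤ autocov κ₀ π₀ (fun x => ∫ ω, G (x, ω) ∂(κF x)) 0
      / autocov ((Kernel.prodMkRight E κ₀) ⊗ₖ (Kernel.prodMkLeft (Ω × E) κF))
          (π₀ ⊗ₘ κF) G 0 := div_nonneg hC0 hpos.le
  have hr1 : autocov κ₀ π₀ (fun x => ∫ ω, G (x, ω) ∂(κF x)) 0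
      / autocov ((Kernel.prodMkRight E κ₀) ⊗ₖ (Kernel.prodMkLeft (Ω × E) κF))
          (π₀ ⊗ₘ κF) G 0 ≤ 1 := (div_le_one hpos).2 hle
  constructor <;> nlinarith

/-! ### A Doeblin constant of the PRIOR chain controls the record autocorrelations -/

variable {ε : ℝ≥0∞}

/-- **Envelope transfer**: if the prior chain satisfies `κ₀(x, ·) ≥ ε π₀` then for every bounded
measurable `Π`-centred record observable `|C^K_G(t + 1)| ≤ (1 − ε)^{t+1} · ∫ h² dπ₀`
(`≤ (1 − ε)^{t+1} Var_Π G`). -/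
theorem abs_autocov_restart_le_of_doeblin (hπ₀ : Kernel.Invariant κ₀ π₀)
    (hmin : ∀ x {B : Set Ω}, MeasurableSet B → ε * π₀ B ≤ κ₀ x B) {G : Ω × E → ℝ}
    (hG : Measurable G) {C : ℝ} (hC : ∀ p, |G p| ≤ C) (hG0 : ∫ p, G p ∂(π₀ ⊗ₘ κF) = 0) (t : ℕ) :
    |autocov ((Kernel.prodMkRight E κ₀) ⊗ₖ (Kernel.prodMkLeft (Ω × E) κF))
        (π₀ ⊗ₘ κF) G (t + 1)|
      ≤ (1 - ε.toReal) ^ (t + 1) * ∫ x, (∫ ω, G (x, ω) ∂(κF x)) ^ 2 ∂π₀ := by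
  have hh0 : ∫ x, (∫ ω, G (x, ω) ∂(κF x)) ∂π₀ = 0 := by rw [integral_condMean hG hC, hG0]
  rw [autocov_restart_succ hG hC t]
  exact abs_autocov_le_of_doeblin hπ₀ hmin (measurable_condMean (κF := κF) hG)
    (fun x => abs_condMean_le (κF := κF) hC x) hh0 (t + 1)

/-- **`τ_int^K(G) ≤ 1/ε − 1/2`** (indeed `≤ 1/2 + (∫h²dπ₀/∫G²dΠ)(1/ε − 1)`) for every bounded
measurable `Π`-centred record observable, under a Doeblin constant `ε > 0` of the prior chain. -/
theorem tauInt_restart_le_of_doeblin (hπ₀ : Kernel.Invariant κ₀ π₀)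
    (hmin : ∀ x {B : Set Ω}, MeasurableSet B → ε * π₀ B ≤ κ₀ x B) (hε0 : 0 < ε) {G : Ω × E → ℝ}
    (hG : Measurable G) {C : ℝ} (hC : ∀ p, |G p| ≤ C) (hG0 : ∫ p, G p ∂(π₀ ⊗ₘ κF) = 0) :
    tauInt (fun t =>
        autocov ((Kernel.prodMkRight E κ₀) ⊗ₖ (Kernel.prodMkLeft (Ω × E) κF))
            (π₀ ⊗ₘ κF) G t
          / autocov ((Kernel.prodMkRight E κ₀) ⊗ₖ (Kernel.prodMkLeft (Ω × E) κF))
            (π₀ ⊗ₘ κF) G 0)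
      ≤ 1 / ε.toReal - 1 / 2 := by
  set K := (Kernel.prodMkRight E κ₀) ⊗ₖ (Kernel.prodMkLeft (Ω × E) κF) with hK
  have hε1 := eps_le_one_of_doeblin hmin
  have hεr0 : 0 < ε.toReal :=
    ENNReal.toReal_pos hε0.ne' (ne_top_of_le_ne_top ENNReal.one_ne_top hε1)
  have hl0 : 0 ≤ 1 - ε.toReal := one_sub_toReal_nonneg_of_doeblin hmin
  have hl1 : 1 - ε.toReal < 1 := by linarith
  have habs : |1 - ε.toReal| < 1 := by rw [abs_of_nonneg hl0]; exact hl1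
  have hgeo := hasSum_geometric_succ habs
  have hV0 : 0 ≤ autocov K (π₀ ⊗ₘ κF) G 0 := by
    rw [autocov_zero]; exact integral_nonneg fun x => sq_nonneg _
  have hle0 := autocov_restart_zero_ge (κ₀ := κ₀) (κF := κF) (π₀ := π₀) hG hC
  rw [← hK] at hle0
  have hh2 : ∫ x, (∫ ω, G (x, ω) ∂(κF x)) ^ 2 ∂π₀ = autocov κ₀ π₀ (fun x => ∫ ω, G (x, ω) ∂(κF x)) 0 :=
    (autocov_zero _ _ _).symm
  -- termwise: ρ^K(t+1) ≤ (1 − ε)^{t+1}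
  have henv : ∀ t, |autocov K (π₀ ⊗ₘ κF) G (t + 1) / autocov K (π₀ ⊗ₘ κF) G 0|
      ≤ (1 - ε.toReal) ^ (t + 1) := by
    intro t
    have h := abs_autocov_restart_le_of_doeblin (κF := κF) hπ₀ hmin hG hC hG0 t
    rw [← hK, hh2] at h
    rcases hV0.eq_or_lt with hz | hpos
    · rw [← hz, div_zero, abs_zero]; exact pow_nonneg hl0 _
    · rw [abs_div, abs_of_pos hpos, div_le_iff₀ hpos]
      refine h.trans ?_
      exact mul_le_mul_of_nonneg_left hle0 (pow_nonneg hl0 _)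
  have hsum : Summable fun t : ℕ => autocov K (π₀ ⊗ₘ κF) G (t + 1) / autocov K (π₀ ⊗ₘ κF) G 0 :=
    Summable.of_norm_bounded hgeo.summable fun t => by rw [Real.norm_eq_abs]; exact henv t
  have hle : ∑' t : ℕ, autocov K (π₀ ⊗ₘ κF) G (t + 1) / autocov K (π₀ ⊗ₘ κF) G 0
      ≤ (1 - ε.toReal) / (1 - (1 - ε.toReal)) := by
    rw [← hgeo.tsum_eq]
    exact Summable.tsum_le_tsum (fun t => (le_abs_self _).trans (henv t)) hsum hgeo.summable
  unfold tauInt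
  have hε' : (1 - ε.toReal) / (1 - (1 - ε.toReal)) = 1 / ε.toReal - 1 := by
    rw [sub_sub_cancel, sub_div, div_self hεr0.ne']
  linarith [hle, hε']

/-! ### The stride dictionary -/

/-- **Restart every `m` sweeps**: with `κ₀ = nHit κ m`, `C^K_G(t + 1) = C^{κ}_h(m (t + 1))` — the prior
SWEEP chain's autocovariance of the conditional mean at lag `m(t+1)`. -/
theorem autocov_restart_succ_nHit (κ : Kernel Ω Ω) [IsMarkovKernel κ] (m : ℕ)
    {G : Ω × E → ℝ} (hG : Measurable G) {C : ℝ} (hC : ∀ p, |G p| ≤ C) (t : ℕ) :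
    autocov ((Kernel.prodMkRight E (nHit κ m)) ⊗ₖ (Kernel.prodMkLeft (Ω × E) κF))
        (π₀ ⊗ₘ κF) G (t + 1)
      = autocov κ π₀ (fun x => ∫ ω, G (x, ω) ∂(κF x)) (m * (t + 1)) := by
  haveI := isMarkovKernel_nHit κ m
  rw [autocov_restart_succ hG hC t]
  unfold autocov
  rw [iterate_kop_nHit κ m (measurable_condMean (κF := κF) hG)
    (fun x => abs_condMean_le (κF := κF) hC x) (t + 1)]

end Restart

end Summit.Ventures.LatticeQCDFlow.Scoring

end
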